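import Literature.NumberTheory.Automorphic.SatakeParameterUnitBound
import Literature.NumberTheory.Automorphic.GJUnfoldingLocal
import Literature.NumberTheory.Automorphic.SatakeParametersGLProofs
import HarnessLib

/-!
# Jacquet–Shalika's bound `|μ_{j,v}| ≤ q_v^{1/2}` in rank `≤ 2`, unconditionally

Topic `NumberTheory/Automorphic`; proof file (theorems only, no definition, no named fact),
companion to `AutomorphicLFunctionProofs` (the named fact `norm_satakeParameter_le_sqrt`,
Jacquet–Shalika (1981), (5.1.3) p. 554), `SatakeParameterUnitBound` (the fact for `n ≤ 1`) and
`SatakeParameterGenericBound` (the printed architecture in every rank, through Cor. (2.5) and the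
genericity of cuspidal local components).

## Main statement

* `norm_satakeParameter_le_sqrt_of_le_two (hn : n ≤ 2) : norm_satakeParameter_le_sqrt`: for a
  cuspidal automorphic representation `Π` of `GL_n(𝔸_K)`, `n ≤ 2`, every Hecke–Satake parameter
  `a ∈ α v` at an unramified place `v` satisfies `|a| ≤ q_v^{1/2}` — with a genuine proof over the
  tree's honest `L²`/Hecke-operator definitions and **no named input**.

For `GL₂` this is the classical "trivial bound" towards the Ramanujan conjecture
(Sarnak (2005), §1: unitarity gives `|α_v| ≤ q_v^{1/2}` for `GL₂`; compare Gelbart (1975), §5,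
and Bump (1997), §3.5 for the unitary-dual description behind it): Jacquet–Shalika's theorem is
the same exponent `1/2` in *every* rank, which for `n ≥ 3` needs genericity (the trivial
representation of `GL₃(F)` is unitary and unramified with parameters `q, 1, q⁻¹`).

## The argument (`n = 2`; all proved)

Let `f ≠ 0` be the `K(𝔫)`-fixed eigenvector of `HasSatakeParameterAt` (`v ∤ 𝔫 ≠ 0`, uniformizer
`ϖ`), read in `L² = L²(GL₂(K) A_G \ GL₂(𝔸_K))`, where `GL₂(K_v)` acts through
`ρ_v = R ∘ ι_v` (`rightRegularLocal`) by isometries. It is a spherical vector at `v`, and the local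
operators `T_i = [GL₂(𝒪_v) t_i GL₂(𝒪_v)]`, `t_1 = diag(ϖ, 1)`, `t_2 = diag(ϖ, ϖ)`, act on it by
`T₁ f = q^{1/2} e₁ f`, `T₂ f = e₂ f`, `e_i = e_i(α v)`
(`heckeOperator_rightRegularLocal_heckeDiag_eq_smul` of `GJUnfoldingLocal`). Then:

1. `|e₂| = 1`: `t₂` is central, so `T₂ = ρ_v(t₂)` on fixed vectors
   (`heckeOperator_apply_of_forall_commute`), an isometry.
2. `|q^{1/2} e₁| ≤ q + 1`: a Hecke eigenvalue is bounded by the number of left cosets in the double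
   coset (`norm_le_ncard_orbit_of_heckeOperator_apply_eq_smul` of `SatakeParameterTrivialBound`), and
   `#(GL₂(𝒪_v) t₁ GL₂(𝒪_v) / GL₂(𝒪_v)) = q + 1` from the explicit transversal of
   `HeckeTransversalGL` (`bijOn_heckeTransversal`: pivot sets `{0}`, `{1}` contribute `1` and `q`;
   `ncard_orbit_glInt_heckeDiag_two_one`).
3. **The unitarity symmetry `e₁ = e₂ ē₁`.** With `X = ⟪ρ_v(t₁) f, f⟫`:
   `⟪T₁ f, f⟫ = (q+1) X` (each representative is `k t₁ k'`, `k, k' ∈ GL₂(𝒪_v)`, and `ρ_v` is unitary),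
   while `⟪T₁ f, f⟫ = \overline{q^{1/2} e₁} ‖f‖²`; and `\bar X = ⟪f, ρ_v(t₁) f⟫ = ⟪f, ρ_v(w t₁ w⁻¹) f⟫`
   for the permutation matrix `w ∈ GL₂(𝒪_v)` with `w t₁ w⁻¹ = diag(1, ϖ) = t₁⁻¹ t₂`
   (`permGL_mul_heckeDiag`), whence `\bar X = ⟪f, ρ_v(t₁)⁻¹ (e₂ f)⟫ = e₂ X`. Comparing,
   `q^{1/2} e₁ = e₂ \overline{q^{1/2} e₁}`.
4. **Elementary endgame** (`norm_le_of_norm_mul_eq_one_of_eq_mul_conj`): if `α v = {a, b}` with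
   `|ab| = 1`, `a + b = ab(\bar a + \bar b)` and `|a + b| ≤ q^{1/2} + q^{-1/2}`, then
   `|a|, |b| ≤ q^{1/2}`: if `|a| = r > q^{1/2}` the symmetry forces `b = a / r²`, so
   `|a + b| = r + r⁻¹ > q^{1/2} + q^{-1/2}` (`x ↦ x + x⁻¹` increases on `[1, ∞)`).

For `n ≤ 1` the statement is `norm_satakeParameter_le_sqrt_of_le_one` (`SatakeParameterUnitBound`).

## References

* H. Jacquet, J. A. Shalika, *On Euler products and the classification of automorphic
  representations I*, Amer. J. Math. 103 (1981), (5.1.3) p. 554, Cor. (2.5) p. 515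
  [JacquetShalikaAJM1981].
* P. Sarnak, *Notes on the generalized Ramanujan conjectures*, Clay Math. Proc. 4 (2005), §1.
* S. Gelbart, *Automorphic forms on adele groups*, Ann. of Math. Stud. 83 (1975), §5 [Gelbart1975].
* D. Bump, *Automorphic forms and representations* (1997), §3.3–3.5 [Bump1997].
* G. Shimura, *Introduction to the arithmetic theory of automorphic functions* (1971), §3.2
  (`GL₂(𝒪) diag(ϖ,1) GL₂(𝒪)` is the union of `q + 1` left cosets) [ShimuraIATAF1971].
-/

noncomputable section

open scoped MatrixGroups ComplexConjugate InnerProductSpace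
open NumberField IsDedekindDomain MeasureTheory Complex ValuativeRel

namespace Literature.NumberTheory.Automorphic

open Echelon Literature.LinearAlgebra.Matrix.Echelon

/-! ### The elementary endgame -/

section Elementary

/-- **Roots of a "unitary" quadratic are bounded by `s`.** If `a, b ∈ ℂ` satisfy `|ab| = 1`,
`a + b = ab(\bar a + \bar b)` (i.e. `{a, b} = {\bar a⁻¹, \bar b⁻¹}`) and `|a + b| ≤ s + s⁻¹` with
`s > 1`, then `|a| ≤ s`. Indeed if `|a| = r > s`, the symmetry gives `(r² - 1)(a + b) = a (r² - |b|²)`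
with `|b|² = r⁻²`, so `|a + b| = r + r⁻¹ > s + s⁻¹`. (The shape of the unramified unitary dual of
`GL₂(F)`: tempered parameters or a complementary pair `χ|·|^{±σ}`; Bump (1997), §3.5;
Gelbart (1975), §5.) [folklore] -/
theorem norm_le_of_norm_mul_eq_one_of_eq_mul_conj {a b : ℂ} {s : ℝ} (hs : 1 < s)
    (h2 : ‖a * b‖ = 1) (h1 : ‖a + b‖ ≤ s + s⁻¹) (hsym : a + b = a * b * conj (a + b)) :
    ‖a‖ ≤ s := by
  by_contra hlt
  rw [not_le] at hlt
  set r : ℝ := ‖a‖ with hr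
  have hs0 : 0 < s := one_pos.trans hs
  have hr1 : 1 < r := hs.trans hlt
  have hr0 : 0 < r := one_pos.trans hr1
  have hna : Complex.normSq a = r ^ 2 := by rw [Complex.normSq_eq_norm_sq]
  have hnab : Complex.normSq a * Complex.normSq b = 1 := by
    rw [← Complex.normSq_mul, Complex.normSq_eq_norm_sq, h2, one_pow]
  have hnb : Complex.normSq b = (r ^ 2)⁻¹ := by
    rw [← hna]
    exact (inv_eq_of_mul_eq_one_right hnab).symm
  -- the key identity
  have ha : a * conj a = (Complex.normSq a : ℂ) := Complex.mul_conj a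
  have hb : b * conj b = (Complex.normSq b : ℂ) := Complex.mul_conj b
  have hsym' : a + b = a * b * conj a + a * b * conj b := by rw [hsym, map_add, mul_add]
  have key : ((Complex.normSq a : ℂ) - 1) * (a + b) =
      a * ((Complex.normSq a : ℂ) - (Complex.normSq b : ℂ)) := by
    linear_combination -hsym' - b * ha - a * hb
  -- take norms
  have hnorm : (r ^ 2 - 1) * ‖a + b‖ = r * (r ^ 2 - (r ^ 2)⁻¹) := by
    have h := congrArg norm key
    rw [norm_mul, norm_mul, hna, hnb, ← Complex.ofReal_one, ← Complex.ofReal_sub,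
      ← Complex.ofReal_sub, Complex.norm_real, Complex.norm_real,
      Real.norm_of_nonneg (by nlinarith), Real.norm_of_nonneg, ← hr] at h
    · exact h
    · rw [sub_nonneg]
      calc (r ^ 2)⁻¹ ≤ 1 := inv_le_one_of_one_le₀ (by nlinarith)
        _ ≤ r ^ 2 := by nlinarith
  have hE : ‖a + b‖ = r + r⁻¹ := by
    have hne : r ^ 2 - 1 ≠ 0 := by nlinarith
    refine mul_left_cancel₀ hne ?_
    rw [hnorm]
    field_simp
    ring
  -- `x ↦ x + x⁻¹` is strictly increasing on `[1, ∞)`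
  have hlt' : s + s⁻¹ < r + r⁻¹ := by
    rw [← sub_pos]
    have : r + r⁻¹ - (s + s⁻¹) = (r - s) * (r * s - 1) / (r * s) := by
      field_simp
      ring
    rw [this]
    exact div_pos (mul_pos (sub_pos.2 hlt) (by nlinarith)) (mul_pos hr0 hs0)
  rw [hE] at h1
  exact absurd (h1.trans_lt hlt') (lt_irrefl _)

end Elementary

/-! ### `GL₂(𝒪) diag(ϖ, 1) GL₂(𝒪)` is the union of `q + 1` left cosets -/

section Count

variable {F : Type*} [Field F] [ValuativeRel F]

/-- The pivot sets of size `1` in `Fin 2` are `{0}` and `{1}`. [folklore] -/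
theorem filter_card_univ_fin_two :
    ((Finset.univ : Finset (Finset (Fin 2))).filter fun S => S.card = 2 - 1) = { {0}, {1} } := by
  decide

/-- No echelon position for the pivot set `{0} ⊆ Fin 2` (`c({0}) = 0`). [folklore] -/
theorem card_echelonPositions_zero_fin_two :
    (echelonPositions ({0} : Finset (Fin 2))).card = 0 := by
  decide

/-- One echelon position, `(0, 1)`, for the pivot set `{1} ⊆ Fin 2` (`c({1}) = 1`). [folklore] -/
theorem card_echelonPositions_one_fin_two :
    (echelonPositions ({1} : Finset (Fin 2))).card = 1 := by
  decide

/-- **`#(TransversalIndex 2 F 1) = q + 1`**: the transversal `{u_a ϖ^{ε_S}}` of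
`GL₂(𝒪) diag(ϖ,1) GL₂(𝒪) / GL₂(𝒪)` is indexed by `S = {0}` (one representative, `diag(1, ϖ)`) and
`S = {1}` (`q` representatives `(ϖ a; 0 1)`, `a` a residue) — Shimura (1971), §3.2.
[cite: ShimuraIATAF1971, §3.2] -/
theorem card_transversalIndex_two_one [Fintype 𝓀[F]] :
    Fintype.card (TransversalIndex 2 F 1) = Fintype.card 𝓀[F] + 1 := by
  classical
  have h := sum_transversalIndex_of_fst (n := 2) (F := F) 1 (fun _ => (1 : ℕ))
  rw [Finset.sum_const, Finset.card_univ, smul_eq_mul, mul_one, filter_card_univ_fin_two,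
    Finset.sum_pair (by decide), card_echelonPositions_zero_fin_two,
    card_echelonPositions_one_fin_two, pow_zero, pow_one, smul_eq_mul, smul_eq_mul, mul_one,
    mul_one] at h
  rw [h, add_comm]

/-- **`#(GL₂(𝒪) diag(ϖ, 1) GL₂(𝒪) / GL₂(𝒪)) = q + 1`** for a uniformizing element `ϖ`
(`bijOn_heckeTransversal` of `HeckeTransversalGL` and `card_transversalIndex_two_one`;
Shimura (1971), §3.2). [cite: ShimuraIATAF1971, §3.2] -/
theorem ncard_orbit_glInt_heckeDiag_two_one [Fintype 𝓀[F]] {ϖ : F}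
    (hϖ : IsUniformizingElement ϖ) :
    (MulAction.orbit (glInt 2 F)
      ((heckeDiag 2 (Units.mk0 ϖ hϖ.ne_zero) 1 : GL (Fin 2) F) : GL (Fin 2) F ⧸ glInt 2 F)).ncard =
      Fintype.card 𝓀[F] + 1 := by
  classical
  have hbij := bijOn_heckeTransversal (n := 2) hϖ (r := 1) (by norm_num)
  rw [← hbij.image_eq, hbij.injOn.ncard_image, Set.ncard_coe_finset]
  have hcard : (heckeTransversal (n := 2) hϖ.ne_zero 1).card =
      Fintype.card (TransversalIndex 2 F 1) :=
    (Finset.card_image_of_injective _ (TransversalIndex.rep_injective hϖ)).trans Finset.card_univ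
  rw [hcard, card_transversalIndex_two_one]

end Count

/-! ### The bound for `GL₂` -/

section RankTwo

variable {K : Type} [Field K] [NumberField K]
  {μ : Measure (AdelicGroupData.gl 2 K).automorphicQuotient}
  [(AdelicGroupData.gl 2 K).IsAutomorphicMeasure μ]

/-- `⟪ρ_v(g) x, y⟫ = ⟪x, ρ_v(g⁻¹) y⟫` for the local representation `ρ_v = R ∘ ι_v` of `GL₂(K_v)`
on `L²` (the regular representation is unitary). [folklore] -/
theorem inner_rightRegularLocal_apply_left (v : HeightOneSpectrum (𝓞 K))
    (g : GL (Fin 2) (v.adicCompletion K)) (x y : (AdelicGroupData.gl 2 K).L2 μ) :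
    ⟪rightRegularLocal μ v g x, y⟫_ℂ = ⟪x, rightRegularLocal μ v g⁻¹ y⟫_ℂ := by
  have hU := (AdelicGroupData.gl 2 K).isUnitary_rightRegular μ
  have h1 : rightRegularLocal μ v g (rightRegularLocal μ v g⁻¹ y) = y := by
    rw [← Module.End.mul_apply, ← map_mul, mul_inv_cancel, map_one, Module.End.one_apply]
  calc ⟪rightRegularLocal μ v g x, y⟫_ℂ
      = ⟪rightRegularLocal μ v g x, rightRegularLocal μ v g (rightRegularLocal μ v g⁻¹ y)⟫_ℂ := by
        rw [h1]
    _ = ⟪x, rightRegularLocal μ v g⁻¹ y⟫_ℂ := hU.inner_map_map (GLn.ofLocal 2 K v g) x _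

/-- `⟪x, ρ_v(g) y⟫ = ⟪ρ_v(g⁻¹) x, y⟫`. [folklore] -/
theorem inner_rightRegularLocal_apply_right (v : HeightOneSpectrum (𝓞 K))
    (g : GL (Fin 2) (v.adicCompletion K)) (x y : (AdelicGroupData.gl 2 K).L2 μ) :
    ⟪x, rightRegularLocal μ v g y⟫_ℂ = ⟪rightRegularLocal μ v g⁻¹ x, y⟫_ℂ := by
  rw [inner_rightRegularLocal_apply_left, inv_inv]

/-- **Jacquet–Shalika's bound (5.1.3) for `GL₂`, unconditionally.** For a cuspidal automorphic
representation `Π` of `GL₂(𝔸_K)`, a Satake family `α` of `Π` off `S` and `v ∉ S`, every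
`a ∈ α v` has `|a| ≤ q_v^{1/2}`. Proof as in the module docstring: in `L²` with `GL₂(K_v)` acting
through `ρ_v = R ∘ ι_v`, the eigenvalues `q^{1/2} e₁`, `e₂` of `T₁`, `T₂` on the spherical vector
satisfy `|e₂| = 1` (central `t₂`), `|q^{1/2} e₁| ≤ q + 1` (`q + 1` cosets, isometries) and
`e₁ = e₂ ē₁` (unitarity and `w t₁ w⁻¹ = t₁⁻¹ t₂`), whence `|a| ≤ q^{1/2}` for both roots of
`X² - e₁ X + e₂` (`norm_le_of_norm_mul_eq_one_of_eq_mul_conj`). This is the `GL₂` case of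
Jacquet–Shalika (1981), Cor. (2.5) / (5.1.3), where the printed proof for general `n` goes through
genericity; for `n = 2` unitarity alone suffices (Sarnak (2005), §1).
[cite: JacquetShalikaAJM1981, (5.1.3) p. 554, Cor. (2.5) p. 515] -/
theorem norm_satakeParameter_le_sqrt_two :
    norm_satakeParameter_le_sqrt (n := 2) (K := K) (μ := μ) := by
  intro P S α hα v hv a ha
  classical
  obtain ⟨𝔫, h𝔫, hv𝔫, ϖ, hsat⟩ := hα v hv
  have hsat' := hsat
  obtain ⟨hϖv, hcardα, f, hfK, hf0, -⟩ := hsat'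
  -- notation
  set q : ℕ := v.residueCard with hq
  set ρv : Representation ℂ (GL (Fin 2) (v.adicCompletion K)) ((AdelicGroupData.gl 2 K).L2 μ) :=
    rightRegularLocal μ v with hρv
  set t : GL (Fin 2) (v.adicCompletion K) := heckeDiag 2 ϖ 1 with ht
  set z : GL (Fin 2) (v.adicCompletion K) := heckeDiag 2 ϖ 2 with hz
  set x : (AdelicGroupData.gl 2 K).L2 μ := ((f : P.1.toSubmodule) : (AdelicGroupData.gl 2 K).L2 μ)
    with hx
  have hq1 : 1 < q := v.one_lt_residueCard
  -- `x` is a non-zero spherical vector at `v`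
  have hxsph : x ∈ sphericalVectorsAt μ P v := by
    refine mem_sphericalVectorsAt_iff.2 ⟨f.2, fun k hk => ?_⟩
    have hkK : GLn.ofLocal 2 K v k ∈ principalCongruenceLevel 2 K 𝔫 := by
      refine isMaximalAt_principalCongruenceLevel 2 K v h𝔫 hv𝔫 ⟨k, ?_, rfl⟩
      rw [← glInt_adicCompletion_eq]
      exact hk
    exact congrArg Subtype.val ((P.1.mem_fixedVectors _ f).1 hfK _ hkK)
  have hx0 : x ≠ 0 := fun h => hf0 (Subtype.ext h)
  have hxK : x ∈ ρv.fixedPoints (glInt 2 (v.adicCompletion K)) := by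
    rw [Representation.mem_fixedPoints]
    intro k hk
    exact (mem_sphericalVectorsAt_iff.1 hxsph).2 k hk
  -- the eigenvalue equations of `T₁`, `T₂` in `L²`
  have hT1 : heckeOperator ρv (glInt 2 (v.adicCompletion K)) t x =
      ((((Real.sqrt (q : ℝ) : ℝ) : ℂ)) * (α v).esymm 1) • x := by
    have h := heckeOperator_rightRegularLocal_heckeDiag_eq_smul h𝔫 hv𝔫 hsat hxsph (i := 1)
      (by norm_num)
    simpa only [show 1 * (2 - 1) = 1 from rfl, pow_one] using h
  have hT2 : heckeOperator ρv (glInt 2 (v.adicCompletion K)) z x = (α v).esymm 2 • x := by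
    have h := heckeOperator_rightRegularLocal_heckeDiag_eq_smul h𝔫 hv𝔫 hsat hxsph (i := 2) le_rfl
    simpa only [show 2 * (2 - 2) = 0 from rfl, pow_zero, one_mul] using h
  -- (1) `|e₂| = 1`: `T₂ = ρ_v(t₂)` on fixed vectors, an isometry
  have hρz : ρv z x = (α v).esymm 2 • x := by
    rw [← hT2]
    exact (heckeOperator_apply_of_forall_commute ρv (glInt 2 (v.adicCompletion K))
      (fun y => mul_heckeDiag_self_comm ϖ y) hxK).symm
  have hxn : ‖x‖ ≠ 0 := norm_ne_zero_iff.2 hx0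
  have he2 : ‖(α v).esymm 2‖ = 1 := by
    have h := AdelicGroupData.norm_rightRegular_apply (AdelicGroupData.gl 2 K) μ
      (GLn.ofLocal 2 K v z) x
    have h' : ‖ρv z x‖ = ‖x‖ := h
    rw [hρz, norm_smul] at h'
    exact mul_right_cancel₀ hxn (h'.trans (one_mul _).symm)
  -- (2) the count `q + 1` and the trivial bound `|q^{1/2} e₁| ≤ q + 1`
  haveI : Fintype 𝓀[v.adicCompletion K] := Fintype.ofFinite _
  have hϖu : IsUniformizingElement ((ϖ : (v.adicCompletion K)ˣ) : v.adicCompletion K) :=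
    isUniformizingElement_of_valued_eq K v hϖv
  have hqcard : Fintype.card 𝓀[v.adicCompletion K] = q := by
    rw [Fintype.card_eq_nat_card, natCard_valuativeResidueField_adicCompletion_eq]
  have hbij := bijOn_heckeTransversal (n := 2) hϖu (r := 1) (by norm_num)
  rw [Units.mk0_val] at hbij
  set s : Finset (GL (Fin 2) (v.adicCompletion K)) := heckeTransversal (n := 2) hϖu.ne_zero 1
    with hs
  have hscard : s.card = q + 1 := by
    have h1 : s.card = Fintype.card (TransversalIndex 2 (v.adicCompletion K) 1) :=
      (Finset.card_image_of_injective _ (TransversalIndex.rep_injective hϖu)).trans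
        Finset.card_univ
    rw [h1, card_transversalIndex_two_one, hqcard]
  have hcount : (MulAction.orbit (glInt 2 (v.adicCompletion K))
      (t : GL (Fin 2) (v.adicCompletion K) ⧸ glInt 2 (v.adicCompletion K))).ncard = q + 1 := by
    rw [← hbij.image_eq, hbij.injOn.ncard_image, Set.ncard_coe_finset, hscard]
  have hbound : ‖(((Real.sqrt (q : ℝ) : ℝ) : ℂ)) * (α v).esymm 1‖ ≤ (q : ℝ) + 1 := by
    have h := norm_le_ncard_orbit_of_heckeOperator_apply_eq_smul ρv
      (fun g y => (AdelicGroupData.norm_rightRegular_apply (AdelicGroupData.gl 2 K) μ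
        (GLn.ofLocal 2 K v g) y).le)
      (glInt 2 (v.adicCompletion K)) t hx0 hT1
    rw [hcount] at h
    exact_mod_cast h
  -- (3) the unitarity symmetry `q^{1/2} e₁ = e₂ \overline{q^{1/2} e₁}`
  have hTsum : heckeOperator ρv (glInt 2 (v.adicCompletion K)) t x = ∑ y ∈ s, ρv y x :=
    heckeOperator_apply_eq_sum ρv (glInt 2 (v.adicCompletion K)) t s hbij hxK
  have hterm : ∀ y ∈ s, ⟪ρv y x, x⟫_ℂ = ⟪ρv t x, x⟫_ℂ := by
    intro y hy
    have hy' := (mk_mem_orbit_iff (glInt 2 (v.adicCompletion K)) t y).1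
      (hbij.mapsTo (Finset.mem_coe.2 hy))
    obtain ⟨k, hk, k', hk', rfl⟩ := DoubleCoset.mem_doubleCoset.1 hy'
    have hk'x : ρv k' x = x := (Representation.mem_fixedPoints _ _ _).1 hxK k' hk'
    have hkx : ρv k⁻¹ x = x := (Representation.mem_fixedPoints _ _ _).1 hxK k⁻¹ (inv_mem hk)
    rw [map_mul, map_mul, Module.End.mul_apply, Module.End.mul_apply, hk'x,
      inner_rightRegularLocal_apply_left, hkx]
  have hinnerT : ⟪heckeOperator ρv (glInt 2 (v.adicCompletion K)) t x, x⟫_ℂ =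
      (s.card : ℂ) * ⟪ρv t x, x⟫_ℂ := by
    rw [hTsum, sum_inner, Finset.sum_congr rfl hterm, Finset.sum_const, nsmul_eq_mul]
  set lam : ℂ := (((Real.sqrt (q : ℝ) : ℝ) : ℂ)) * (α v).esymm 1 with hlam
  have hX1 : conj lam * ⟪x, x⟫_ℂ = (s.card : ℂ) * ⟪ρv t x, x⟫_ℂ := by
    rw [← hinnerT, hT1, inner_smul_left]
  -- the permutation `w` with `w t₁ = diag(1, ϖ) w` and `t₁ diag(1, ϖ) = t₂`
  obtain ⟨σ, hσ⟩ := exists_perm_lt_iff_not_mem (n := 2) (r := 1) (S := ({0} : Finset (Fin 2)))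
    (by norm_num) (by decide)
  set w : GL (Fin 2) (v.adicCompletion K) := permGL σ with hw
  have hwK : w ∈ glInt 2 (v.adicCompletion K) := permGL_mem_glInt σ
  have hwt : w * t = piPowGL ϖ.ne_zero (epsOf ({0} : Finset (Fin 2))) * w :=
    permGL_mul_heckeDiag hσ ϖ
  have htt' : t * piPowGL ϖ.ne_zero (epsOf ({0} : Finset (Fin 2))) = z := by
    refine Units.ext ?_
    rw [Units.val_mul, ht, hz, coe_heckeDiag, coe_heckeDiag, coe_piPowGL]
    unfold Echelon.piPow
    rw [Matrix.diagonal_mul_diagonal]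
    congr 1
    funext j
    fin_cases j <;> simp [epsOf]
  have ht' : piPowGL ϖ.ne_zero (epsOf ({0} : Finset (Fin 2))) = t⁻¹ * z := by
    rw [← htt', inv_mul_cancel_left]
  have hw'x : ρv w⁻¹ x = x := (Representation.mem_fixedPoints _ _ _).1 hxK w⁻¹ (inv_mem hwK)
  have hconjX : conj ⟪ρv t x, x⟫_ℂ = (α v).esymm 2 * ⟪ρv t x, x⟫_ℂ := by
    calc conj ⟪ρv t x, x⟫_ℂ = ⟪x, ρv t x⟫_ℂ := inner_conj_symm x (ρv t x)
      _ = ⟪ρv w⁻¹ x, ρv t x⟫_ℂ := by rw [hw'x]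
      _ = ⟪x, ρv w (ρv t x)⟫_ℂ := by rw [inner_rightRegularLocal_apply_left, inv_inv]
      _ = ⟪x, ρv w (ρv t (ρv w⁻¹ x))⟫_ℂ := by rw [hw'x]
      _ = ⟪x, ρv (w * t * w⁻¹) x⟫_ℂ := by
          rw [map_mul, map_mul, Module.End.mul_apply, Module.End.mul_apply]
      _ = ⟪x, ρv (t⁻¹ * z) x⟫_ℂ := by rw [hwt, mul_inv_cancel_right, ht']
      _ = ⟪x, ρv t⁻¹ (ρv z x)⟫_ℂ := by rw [map_mul, Module.End.mul_apply]
      _ = (α v).esymm 2 * ⟪x, ρv t⁻¹ x⟫_ℂ := by rw [hρz, map_smul, inner_smul_right]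
      _ = (α v).esymm 2 * ⟪ρv t x, x⟫_ℂ := by rw [← inner_rightRegularLocal_apply_left]
  have hxx : ⟪x, x⟫_ℂ ≠ 0 := inner_self_ne_zero.2 hx0
  have hlam_symm : lam = (α v).esymm 2 * conj lam := by
    have h := congrArg conj hX1
    rw [map_mul, Complex.conj_conj, inner_self_conj, map_mul, Complex.conj_natCast, hconjX] at h
    -- `h : lam * ⟪x, x⟫ = N * (e₂ * X)`
    have h2 : lam * ⟪x, x⟫_ℂ = (α v).esymm 2 * conj lam * ⟪x, x⟫_ℂ := by
      rw [h, mul_assoc ((α v).esymm 2), hX1]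
      ring
    exact mul_right_cancel₀ hxx h2
  have hsqrt_pos : 0 < Real.sqrt (q : ℝ) :=
    Real.sqrt_pos.2 (by exact_mod_cast (zero_lt_one.trans hq1))
  have hsqrt0 : (((Real.sqrt (q : ℝ) : ℝ) : ℂ)) ≠ 0 := by
    exact_mod_cast hsqrt_pos.ne'
  have he1 : (α v).esymm 1 = (α v).esymm 2 * conj ((α v).esymm 1) := by
    have h := hlam_symm
    rw [hlam, map_mul, Complex.conj_ofReal] at h
    have h2 : (((Real.sqrt (q : ℝ) : ℝ) : ℂ)) * (α v).esymm 1 =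
        (((Real.sqrt (q : ℝ) : ℝ) : ℂ)) * ((α v).esymm 2 * conj ((α v).esymm 1)) := by
      rw [h]
      ring
    exact mul_left_cancel₀ hsqrt0 h2
  -- (4) read off the two parameters
  obtain ⟨a', b', hab⟩ := Multiset.card_eq_two.1 hcardα
  have he1v : (α v).esymm 1 = a' + b' := by
    rw [hab]
    simp [Multiset.esymm, Multiset.powersetCard_one]
    exact add_comm _ _
  have he2v : (α v).esymm 2 = a' * b' := by
    rw [hab]
    simp [Multiset.esymm, Multiset.powersetCard_one, Multiset.powersetCard_cons]
  set sq : ℝ := Real.sqrt (q : ℝ) with hsq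
  have hsq1 : 1 < sq := by
    rw [hsq, Real.lt_sqrt zero_le_one, one_pow]
    exact_mod_cast hq1
  have hsq0 : 0 < sq := one_pos.trans hsq1
  have hsq2 : (q : ℝ) = sq ^ 2 := by rw [hsq, Real.sq_sqrt (Nat.cast_nonneg _)]
  have he1bound : ‖a' + b'‖ ≤ sq + sq⁻¹ := by
    have h := hbound
    rw [norm_mul, Complex.norm_real, Real.norm_of_nonneg hsq0.le, he1v, hsq2] at h
    -- `h : sq * ‖a' + b'‖ ≤ sq ^ 2 + 1`
    calc ‖a' + b'‖ = sq * ‖a' + b'‖ / sq := by field_simp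
      _ ≤ (sq ^ 2 + 1) / sq := div_le_div_of_nonneg_right h hsq0.le
      _ = sq + sq⁻¹ := by field_simp
  rw [he1v, he2v] at he1
  rw [he2v] at he2
  have hmem : a = a' ∨ a = b' := by
    rw [hab] at ha
    simpa using ha
  rcases hmem with rfl | rfl
  · exact norm_le_of_norm_mul_eq_one_of_eq_mul_conj hsq1 he2 he1bound he1
  · refine norm_le_of_norm_mul_eq_one_of_eq_mul_conj hsq1 (by rwa [mul_comm]) (by rwa [add_comm])
      ?_
    rw [add_comm a a', mul_comm a a']
    exact he1

/-- **Jacquet–Shalika's bound (5.1.3) in rank `n ≤ 2`, unconditionally**: the named fact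
`norm_satakeParameter_le_sqrt` of `AutomorphicLFunctionProofs` holds for `n ≤ 2` with a genuine
proof — `n ≤ 1` by `norm_satakeParameter_le_sqrt_of_le_one` (`SatakeParameterUnitBound`: Hecke
eigenvalues of the commutative `GL₁` have absolute value `1`), `n = 2` by
`norm_satakeParameter_le_sqrt_two` (unitarity). [cite: JacquetShalikaAJM1981, (5.1.3) p. 554] -/
theorem norm_satakeParameter_le_sqrt_of_le_two {n : ℕ}
    {μ : Measure (AdelicGroupData.gl n K).automorphicQuotient}
    [(AdelicGroupData.gl n K).IsAutomorphicMeasure μ] (hn : n ≤ 2) :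
    norm_satakeParameter_le_sqrt (n := n) (K := K) (μ := μ) := by
  rcases Nat.lt_or_ge n 2 with h | h
  · exact norm_satakeParameter_le_sqrt_of_le_one (by omega)
  · obtain rfl : n = 2 := le_antisymm hn h
    exact norm_satakeParameter_le_sqrt_two

end RankTwo

end Literature.NumberTheory.Automorphic
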